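import Summits.NavierStokesRegularity.NavierStokesRegularity.Theorems.FilamentSkeletonRssCoreLinearInvertibilityArnoldModeOne1DFunctionals

/-!
# Tools for stub `stub_arnoldModeOne1D` (crux `CoreLinearInvertibility`,
# stmt-NavierStokesRegularity-17973, route `FilamentSkeletonRss`, line `Sketch`) — part C: the energy and the trace

The `k = 1` Biot–Savart form of Gallay–Šverák, `P(f) = ∫₀^∞ (B₁f)(r) f(r) r dr` with
`(B₁f)(r) = ½ ∫₀^∞ min(r/s, s/r) f(s) s ds = ½ (A_f(r)/r + r B_f(r))`, is the ENERGY
`P(f) = ½ ∫₀^∞ (A_f²/r³ + r B_f²) dr` (one integration by parts on `(0,∞)`; this is `∫ ω ψ = −∫ |∇ψ|²`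
in the first angular mode) — the positive factorisation `B̃₁ = C̃*C̃` behind the trace argument.
Also here: the first trace identity `∫₀^∞ F(r)/r³ dr = ½∫ rΦ` for `F(r) = ∫₀ʳ s³Φ` and the tail
`G(r) = ∫ᵣ^∞ Φ/s` (`Φ = kerWeight`). Folklore calculus; no definitions.
-/

set_option linter.dupNamespace false

noncomputable section

namespace Summit.NavierStokesRegularity.NavierStokesRegularity.Theorems

open Set Function Filter MeasureTheory Topology
open Literature.Analysis.FluidPDE

/-! ### The inner integral and the energy identity -/

/-- **Splitting the mode-one integral at `s = r`**: for `r > 0`,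
`∫₀^∞ min(r/s, s/r) f(s) s ds = A_f(r)/r + r B_f(r)`. [folklore] -/
theorem am1_inner_split {f : ℝ → ℝ} (hf : Continuous f) {C : ℝ} {N : ℕ}
    (hb : ∀ r, 0 ≤ r → |f r| ≤ C * (1 + r) ^ N * Real.exp (-(r ^ 2 / 4))) {r : ℝ} (hr : 0 < r) :
    ∫ s in Ioi (0 : ℝ), min (r / s) (s / r) * f s * s =
      (∫ s in (0 : ℝ)..r, s ^ 2 * f s) / r + r * ∫ s in Ioi r, f s := by
  have hfi : IntegrableOn f (Ioi 0) :=
    (am1_integrableOn_pow_mul hf hb 0).congr_fun (fun r _ => by simp) measurableSet_Ioi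
  -- the integrand on the two pieces
  have h1 : EqOn (fun s : ℝ => min (r / s) (s / r) * f s * s) (fun s : ℝ => r⁻¹ * (s ^ 2 * f s)) (Ioc 0 r) := by
    intro s hs
    have hs0 : 0 < s := hs.1
    have hmin : min (r / s) (s / r) = s / r :=
      min_eq_right (((div_le_one hr).2 hs.2).trans ((one_le_div hs0).2 hs.2))
    simp only [hmin]
    field_simp
  have h2 : EqOn (fun s : ℝ => min (r / s) (s / r) * f s * s) (fun s : ℝ => r * f s) (Ioi r) := by
    intro s hs
    have hs0 : 0 < s := hr.trans hs
    have hmin : min (r / s) (s / r) = r / s :=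
      min_eq_left (((div_le_one hs0).2 (le_of_lt hs)).trans ((one_le_div hr).2 (le_of_lt hs)))
    simp only [hmin]
    field_simp
  have hi1 : IntegrableOn (fun s : ℝ => r⁻¹ * (s ^ 2 * f s)) (Ioc 0 r) :=
    ((((continuous_pow 2).mul hf).const_mul r⁻¹).integrableOn_Icc (a := 0) (b := r)).mono_set
      Ioc_subset_Icc_self
  have hi2 : IntegrableOn (fun s : ℝ => r * f s) (Ioi r) := (hfi.mono_set (Ioi_subset_Ioi hr.le)).const_mul r
  rw [← Ioc_union_Ioi_eq_Ioi hr.le, setIntegral_union (Ioc_disjoint_Ioi le_rfl) measurableSet_Ioi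
    (hi1.congr_fun h1.symm measurableSet_Ioc) (hi2.congr_fun h2.symm measurableSet_Ioi),
    setIntegral_congr_fun measurableSet_Ioc h1, setIntegral_congr_fun measurableSet_Ioi h2,
    MeasureTheory.integral_const_mul, MeasureTheory.integral_const_mul,
    ← intervalIntegral.integral_of_le hr.le]
  ring

/-- **The mode-one energy identity** `∫₀^∞ (B₁f) f r dr = ½ ∫₀^∞ (A_f²/r³ + r B_f²) dr` for a
continuous Gaussian-class `f`, `(B₁f)(r) = ½∫₀^∞ min(r/s,s/r) f(s) s ds`: with
`Ψ = ¼(A_f²/r² − r²B_f²)` one has `Ψ' = ½(A_f f + r²B_f f) − ½(A_f²/r³ + rB_f²)` on `(0,∞)` and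
`Ψ(0⁺) = Ψ(∞) = 0`. This is `∫ ω ψ_ω = −∫|∇ψ_ω|²` in the first angular Fourier mode. [folklore] -/
theorem am1_energy_identity {f : ℝ → ℝ} (hf : Continuous f) {C : ℝ} {N : ℕ}
    (hb : ∀ r, 0 ≤ r → |f r| ≤ C * (1 + r) ^ N * Real.exp (-(r ^ 2 / 4))) :
    ∫ r in Ioi (0 : ℝ), ((1 / 2 : ℝ) * ∫ s in Ioi (0 : ℝ), min (r / s) (s / r) * f s * s) * f r * r =
      (1 / 2) * ∫ r in Ioi (0 : ℝ),
        ((∫ s in (0 : ℝ)..r, s ^ 2 * f s) ^ 2 / r ^ 3 + r * (∫ s in Ioi r, f s) ^ 2) := by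
  set A : ℝ → ℝ := fun r => ∫ s in (0 : ℝ)..r, s ^ 2 * f s with hA
  set B : ℝ → ℝ := fun r => ∫ s in Ioi r, f s with hB
  obtain ⟨K, hK0, hK8, -, hK⟩ := am1_gc_consts hb
  obtain ⟨KB, hKB0, hKB⟩ := am1_abs_B_le_exp hf hK0 hK8
  have hfi : IntegrableOn f (Ioi 0) :=
    (am1_integrableOn_pow_mul hf hb 0).congr_fun (fun r _ => by simp) measurableSet_Ioi
  set I₀ : ℝ := ∫ s in Ioi (0 : ℝ), |f s| with hI₀
  set I₂ : ℝ := ∫ s in Ioi (0 : ℝ), s ^ 2 * |f s| with hI₂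
  have hI₀0 : 0 ≤ I₀ := setIntegral_nonneg measurableSet_Ioi fun s _ => abs_nonneg _
  have hI₂0 : 0 ≤ I₂ := setIntegral_nonneg measurableSet_Ioi fun s _ => mul_nonneg (sq_nonneg s) (abs_nonneg _)
  have hAc : Continuous A := continuous_iff_continuousAt.2 fun r => (am1_hasDerivAt_A hf r).continuousAt
  have hBc : ContinuousOn B (Ici 0) := am1_continuousOn_B hf hfi
  have hA3 : ∀ r, 0 ≤ r → |A r| ≤ K * r ^ 3 := fun r hr => am1_abs_A_le_cube hK hr
  have hAI : ∀ r, 0 ≤ r → |A r| ≤ I₂ := fun r hr => am1_abs_A_le_integral hf hb hr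
  have hBI : ∀ r, 0 ≤ r → |B r| ≤ I₀ := fun r hr => am1_abs_B_le_integral hfi hr
  -- the two integrands
  set p : ℝ → ℝ := fun r => (1 / 2) * (A r * f r + r ^ 2 * (B r * f r)) with hp
  set e : ℝ → ℝ := fun r => (1 / 2) * (A r ^ 2 / r ^ 3 + r * B r ^ 2) with he
  have hLHS : (∫ r in Ioi (0 : ℝ), ((1 / 2 : ℝ) * ∫ s in Ioi (0 : ℝ), min (r / s) (s / r) * f s * s) * f r * r) =
      ∫ r in Ioi (0 : ℝ), p r := by
    refine setIntegral_congr_fun measurableSet_Ioi fun r hr => ?_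
    rw [am1_inner_split hf hb hr]
    have hr0 : r ≠ 0 := ne_of_gt hr
    simp only [hp, hA, hB]
    field_simp
  have hpi : IntegrableOn p (Ioi 0) := by
    have h1 : IntegrableOn (fun r => A r * f r) (Ioi 0) := by
      refine Integrable.mono' (hfi.abs.const_mul I₂) ((hAc.mul hf).aestronglyMeasurable) ?_
      refine (ae_restrict_iff' measurableSet_Ioi).2 (Eventually.of_forall fun r hr => ?_)
      rw [Real.norm_eq_abs, abs_mul]
      exact mul_le_mul_of_nonneg_right (hAI r (le_of_lt hr)) (abs_nonneg _)
    have h2 : IntegrableOn (fun r => r ^ 2 * (B r * f r)) (Ioi 0) := by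
      refine Integrable.mono' ((am1_integrableOn_pow_mul_abs hf hb 2).const_mul I₀) ?_ ?_
      · exact ContinuousOn.aestronglyMeasurable ((continuous_pow 2).continuousOn.mul
          ((hBc.mono Ioi_subset_Ici_self).mul hf.continuousOn)) measurableSet_Ioi
      refine (ae_restrict_iff' measurableSet_Ioi).2 (Eventually.of_forall fun r hr => ?_)
      rw [Real.norm_eq_abs, abs_mul, abs_mul, abs_of_nonneg (sq_nonneg r)]
      calc r ^ 2 * (|B r| * |f r|) ≤ r ^ 2 * (I₀ * |f r|) := by gcongr; exact hBI r (le_of_lt hr)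
        _ = I₀ * (r ^ 2 * |f r|) := by ring
    exact (h1.add h2).const_mul (1 / 2)
  have hei : IntegrableOn e (Ioi 0) :=
    ((am1_integrableOn_A_sq_div hf hb).add (am1_integrableOn_mul_B_sq hf hb)).const_mul (1 / 2)
  -- the primitive `Ψ = ¼(A²/r² − r²B²)`
  set Ψ : ℝ → ℝ := fun r => (1 / 4) * (A r ^ 2 / r ^ 2) - (1 / 4) * (r ^ 2 * B r ^ 2) with hΨ
  have hderiv : ∀ r, 0 < r → HasDerivAt Ψ (p r - e r) r := by
    intro r hr
    have hA' : HasDerivAt A (r ^ 2 * f r) r := am1_hasDerivAt_A hf r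
    have hB' : HasDerivAt B (-f r) r := am1_hasDerivAt_B hf hfi hr
    have h1 := ((hA'.pow 2).div (hasDerivAt_pow 2 r) (pow_ne_zero 2 hr.ne')).const_mul (1 / 4)
    have h2 := ((hasDerivAt_pow 2 r).mul (hB'.pow 2)).const_mul (1 / 4)
    refine (h1.sub h2).congr_deriv ?_
    simp only [hp, he, Pi.pow_apply]
    push_cast
    field_simp
    ring
  have h0 : Tendsto Ψ (𝓝[>] 0) (𝓝 0) := by
    refine am1_tendsto_zero_nhdsGT (b := fun r => (1 / 4) * (K ^ 2 * r ^ 4) + (1 / 4) * (r ^ 2 * I₀ ^ 2))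
      (by fun_prop) (by simp) fun r hr => ?_
    have hA2 : A r ^ 2 ≤ (K * r ^ 3) ^ 2 := by
      rw [← sq_abs]; exact pow_le_pow_left₀ (abs_nonneg _) (hA3 r hr.le) 2
    have hB2 : B r ^ 2 ≤ I₀ ^ 2 := by
      rw [← sq_abs]; exact pow_le_pow_left₀ (abs_nonneg _) (hBI r hr.le) 2
    simp only [hΨ]
    rw [abs_le]
    constructor
    · have : (1 / 4) * (r ^ 2 * B r ^ 2) ≤ (1 / 4) * (r ^ 2 * I₀ ^ 2) := by gcongr
      have : 0 ≤ (1 / 4) * (A r ^ 2 / r ^ 2) := by positivity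
      nlinarith [sq_nonneg (K * r ^ 2), sq_nonneg K]
    · have h3 : A r ^ 2 / r ^ 2 ≤ K ^ 2 * r ^ 4 := by
        rw [div_le_iff₀ (pow_pos hr 2)]
        calc A r ^ 2 ≤ (K * r ^ 3) ^ 2 := hA2
          _ = K ^ 2 * r ^ 4 * r ^ 2 := by ring
      have : 0 ≤ (1 / 4) * (r ^ 2 * B r ^ 2) := by positivity
      nlinarith [sq_nonneg (r * I₀)]
  have hinf : Tendsto Ψ atTop (𝓝 0) := by
    have hb1 : Tendsto (fun r : ℝ => (1 / 4) * (I₂ ^ 2 * (r ^ 2)⁻¹) +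
        (1 / 4) * (KB ^ 2 * (r ^ 2 * Real.exp (-(r ^ 2 / 8))))) atTop (𝓝 0) := by
      have h1 := (tendsto_inv_atTop_zero.comp (tendsto_pow_atTop two_ne_zero)).const_mul (I₂ ^ 2)
      have h2 := (am1_tendsto_pow_mul_exp_neg_sq 2 (by norm_num : (0 : ℝ) < 8)).const_mul (KB ^ 2)
      have h := (h1.const_mul (1 / 4)).add (h2.const_mul (1 / 4))
      simp only [mul_zero, add_zero] at h
      exact h
    refine squeeze_zero_norm' ?_ hb1
    filter_upwards [eventually_gt_atTop (0 : ℝ)] with r hr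
    have hA2 : A r ^ 2 ≤ I₂ ^ 2 := by
      rw [← sq_abs]; exact pow_le_pow_left₀ (abs_nonneg _) (hAI r hr.le) 2
    have hB2 : B r ^ 2 ≤ (KB * Real.exp (-(r ^ 2 / 16))) ^ 2 := by
      rw [← sq_abs]; exact pow_le_pow_left₀ (abs_nonneg _) (hKB r hr.le) 2
    have he2 : Real.exp (-(r ^ 2 / 16)) ^ 2 = Real.exp (-(r ^ 2 / 8)) := by
      rw [← Real.exp_nat_mul]; congr 1; ring
    rw [mul_pow, he2] at hB2
    rw [Real.norm_eq_abs]
    simp only [hΨ]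
    refine (abs_sub _ _).trans ?_
    rw [abs_of_nonneg (by positivity), abs_of_nonneg (by positivity)]
    have h3 : A r ^ 2 / r ^ 2 ≤ I₂ ^ 2 * (r ^ 2)⁻¹ := by
      rw [div_eq_mul_inv]; exact mul_le_mul_of_nonneg_right hA2 (by positivity)
    have h4 : r ^ 2 * B r ^ 2 ≤ KB ^ 2 * (r ^ 2 * Real.exp (-(r ^ 2 / 8))) := by
      calc r ^ 2 * B r ^ 2 ≤ r ^ 2 * (KB ^ 2 * Real.exp (-(r ^ 2 / 8))) := by gcongr
        _ = _ := by ring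
    linarith
  -- integrate
  have hzero := am1_integral_Ioi_eq_zero_of_hasDerivAt hderiv (hpi.sub hei) h0 hinf
  rw [integral_sub hpi hei, sub_eq_zero] at hzero
  rw [hLHS, hzero, he, ← integral_const_mul]

/-! ### The trace identities -/

/-- `F(r) = ∫₀ʳ s³Φ` satisfies `0 ≤ F(r) ≤ r⁴/4` and `F(r) ≤ 32` for `r ≥ 0`. [folklore] -/
theorem am1_F_bounds {r : ℝ} (hr : 0 ≤ r) :
    0 ≤ ∫ s in (0 : ℝ)..r, s ^ 3 * kerWeight s ∧ (∫ s in (0 : ℝ)..r, s ^ 3 * kerWeight s) ≤ r ^ 4 / 4 ∧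
      (∫ s in (0 : ℝ)..r, s ^ 3 * kerWeight s) ≤ 32 := by
  have hc : Continuous fun s : ℝ => s ^ 3 * kerWeight s := (continuous_pow 3).mul continuous_kerWeight
  have hnn : ∀ s, 0 ≤ s → 0 ≤ s ^ 3 * kerWeight s := fun s hs => mul_nonneg (pow_nonneg hs 3) (kerWeight_pos s).le
  refine ⟨intervalIntegral.integral_nonneg hr fun s hs => hnn s hs.1, ?_, ?_⟩
  · calc (∫ s in (0 : ℝ)..r, s ^ 3 * kerWeight s) ≤ ∫ s in (0 : ℝ)..r, s ^ 3 := by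
          refine intervalIntegral.integral_mono_on hr (hc.intervalIntegrable _ _)
            ((continuous_pow 3).intervalIntegrable _ _) fun s hs => ?_
          calc s ^ 3 * kerWeight s ≤ s ^ 3 * 1 := mul_le_mul_of_nonneg_left (kerWeight_le_one s) (pow_nonneg hs.1 3)
            _ = s ^ 3 := mul_one _
      _ = r ^ 4 / 4 := by rw [integral_pow]; norm_num
  · obtain ⟨hv, hi⟩ := am1_integral_pow_three_mul_kerWeight_le
    calc (∫ s in (0 : ℝ)..r, s ^ 3 * kerWeight s) = ∫ s in Ioc 0 r, s ^ 3 * kerWeight s :=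
          intervalIntegral.integral_of_le hr
      _ ≤ ∫ s in Ioi (0 : ℝ), s ^ 3 * kerWeight s :=
          setIntegral_mono_set hi ((ae_restrict_iff' measurableSet_Ioi).2
            (Eventually.of_forall fun s hs => hnn s (le_of_lt hs))) (Eventually.of_forall Ioc_subset_Ioi_self)
      _ ≤ 32 := hv

/-- **First trace identity** `∫₀^∞ F(r)/r³ dr = ½∫₀^∞ rΦ(r) dr`, `F(r) = ∫₀ʳ s³Φ` (by parts with
`Ψ = −F/(2r²)`, `Ψ(0⁺) = Ψ(∞) = 0`), with the integrability of `F/r³` on `(0, ∞)`. [folklore] -/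
theorem am1_integral_F_div_cube :
    IntegrableOn (fun r : ℝ => (∫ s in (0 : ℝ)..r, s ^ 3 * kerWeight s) / r ^ 3) (Ioi 0) ∧
      ∫ r in Ioi (0 : ℝ), (∫ s in (0 : ℝ)..r, s ^ 3 * kerWeight s) / r ^ 3 =
        (1 / 2) * ∫ r in Ioi (0 : ℝ), r * kerWeight r := by
  set F : ℝ → ℝ := fun r => ∫ s in (0 : ℝ)..r, s ^ 3 * kerWeight s with hF
  have hc : Continuous fun s : ℝ => s ^ 3 * kerWeight s := (continuous_pow 3).mul continuous_kerWeight
  have hF' : ∀ r, HasDerivAt F (r ^ 3 * kerWeight r) r := fun r =>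
    intervalIntegral.integral_hasDerivAt_right (hc.intervalIntegrable _ _)
      (hc.stronglyMeasurableAtFilter _ _) hc.continuousAt
  have hFc : Continuous F := continuous_iff_continuousAt.2 fun r => (hF' r).continuousAt
  have hFi : IntegrableOn (fun r : ℝ => F r / r ^ 3) (Ioi 0) := by
    refine am1_integrableOn_of_bounds (M := 1 / 4) (ψ := fun r => 8 * (4 / r ^ 3))
      (hFc.continuousOn.div ((continuous_pow 3).continuousOn) fun r hr => pow_ne_zero 3 (ne_of_gt hr))
      (fun r hr0 hr1 => ?_) ((integral_Ioi_four_div_cube zero_lt_one).2.const_mul 8) (fun r hr => ?_)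
    · obtain ⟨h0, h4, -⟩ := am1_F_bounds hr0.le
      rw [abs_div, abs_of_nonneg h0, abs_of_pos (pow_pos hr0 3), div_le_iff₀ (pow_pos hr0 3)]
      have : r ^ 4 ≤ r ^ 3 := by
        calc r ^ 4 = r ^ 3 * r := by ring
          _ ≤ r ^ 3 * 1 := by gcongr
          _ = r ^ 3 := mul_one _
      linarith
    · have hr0 : 0 < r := zero_lt_one.trans hr
      obtain ⟨h0, -, h32⟩ := am1_F_bounds hr0.le
      rw [abs_div, abs_of_nonneg h0, abs_of_pos (pow_pos hr0 3)]
      calc F r / r ^ 3 ≤ 32 / r ^ 3 := by gcongr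
        _ = 8 * (4 / r ^ 3) := by ring
  refine ⟨hFi, ?_⟩
  set Ψ : ℝ → ℝ := fun r => -(1 / 2) * (F r / r ^ 2) with hΨ
  have hderiv : ∀ r, 0 < r → HasDerivAt Ψ (F r / r ^ 3 - (1 / 2) * (r * kerWeight r)) r := by
    intro r hr
    have h := ((hF' r).div (hasDerivAt_pow 2 r) (pow_ne_zero 2 hr.ne')).const_mul (-(1 / 2))
    refine h.congr_deriv ?_
    push_cast
    field_simp
    ring
  have h0 : Tendsto Ψ (𝓝[>] 0) (𝓝 0) := by
    refine am1_tendsto_zero_nhdsGT (b := fun r => (1 / 2) * (r ^ 2 / 4)) (by fun_prop) (by simp)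
      fun r hr => ?_
    obtain ⟨hF0, h4, -⟩ := am1_F_bounds hr.le
    simp only [hΨ]
    rw [abs_mul, show |-(1 / 2 : ℝ)| = 1 / 2 by norm_num, abs_div, abs_of_nonneg hF0, abs_of_pos (pow_pos hr 2)]
    refine mul_le_mul_of_nonneg_left ?_ (by norm_num)
    rw [div_le_iff₀ (pow_pos hr 2)]
    calc F r ≤ r ^ 4 / 4 := h4
      _ = r ^ 2 / 4 * r ^ 2 := by ring
  have hinf : Tendsto Ψ atTop (𝓝 0) := by
    have hb1 : Tendsto (fun r : ℝ => (1 / 2) * (32 * (r ^ 2)⁻¹)) atTop (𝓝 0) := by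
      have h := (((tendsto_inv_atTop_zero (𝕜 := ℝ)).comp (tendsto_pow_atTop two_ne_zero)).const_mul
        (32 : ℝ)).const_mul (1 / 2)
      simp only [mul_zero] at h
      exact h
    refine squeeze_zero_norm' ?_ hb1
    filter_upwards [eventually_gt_atTop (0 : ℝ)] with r hr
    obtain ⟨hF0, -, h32⟩ := am1_F_bounds hr.le
    rw [Real.norm_eq_abs]
    simp only [hΨ]
    rw [abs_mul, show |-(1 / 2 : ℝ)| = 1 / 2 by norm_num, abs_div, abs_of_nonneg hF0,
      abs_of_pos (pow_pos hr 2)]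
    refine mul_le_mul_of_nonneg_left ?_ (by norm_num)
    rw [← div_eq_mul_inv]
    exact div_le_div_of_nonneg_right h32 (pow_pos hr 2).le
  have hΦi : IntegrableOn (fun r : ℝ => (1 / 2) * (r * kerWeight r)) (Ioi 0) :=
    integrableOn_mul_kerWeight.const_mul _
  have hzero := am1_integral_Ioi_eq_zero_of_hasDerivAt hderiv (hFi.sub hΦi) h0 hinf
  rw [integral_sub hFi hΦi, sub_eq_zero, MeasureTheory.integral_const_mul] at hzero
  exact hzero

/-- The tail `G(r) = ∫ᵣ^∞ Φ(s)/s ds`: integrability on `(r, ∞)` for `r > 0`, the bounds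
`0 ≤ G(r) ≤ (∫₀^∞ Φ)/r` and `r² G(r) ≤ 4e^{−r²/8}` (tree `integral_Ioi_tail_le_exp`). [folklore] -/
theorem am1_G_bounds {r : ℝ} (hr : 0 < r) :
    IntegrableOn (fun s : ℝ => kerWeight s / s) (Ioi r) ∧ 0 ≤ ∫ s in Ioi r, kerWeight s / s ∧
      (∫ s in Ioi r, kerWeight s / s) ≤ (∫ s in Ioi (0 : ℝ), kerWeight s) / r ∧
      r ^ 2 * (∫ s in Ioi r, kerWeight s / s) ≤ 4 * Real.exp (-(r ^ 2 / 8)) := by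
  have hi0 := (integral_Ioi_tail_le_two hr).2
  have hi : IntegrableOn (fun s : ℝ => kerWeight s / s) (Ioi r) := by
    have h' : IntegrableOn (fun s : ℝ => (r ^ 2)⁻¹ * (r ^ 2 * kerWeight s / s)) (Ioi r) :=
      hi0.const_mul _
    refine h'.congr_fun (fun s _ => ?_) measurableSet_Ioi
    have hr2 : r ^ 2 ≠ 0 := pow_ne_zero 2 hr.ne'
    field_simp
  have hΦi : IntegrableOn (fun s : ℝ => kerWeight s) (Ioi 0) := by
    refine Integrable.mono' am1_integrableOn_exp_neg_sq.1 continuous_kerWeight.aestronglyMeasurable ?_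
    exact Eventually.of_forall fun s => by
      rw [Real.norm_of_nonneg (kerWeight_pos s).le]; exact kerWeight_le_exp s
  refine ⟨hi, setIntegral_nonneg measurableSet_Ioi fun s hs => div_nonneg (kerWeight_pos s).le
    (hr.trans hs).le, ?_, ?_⟩
  · calc (∫ s in Ioi r, kerWeight s / s) ≤ ∫ s in Ioi r, kerWeight s / r := by
          refine setIntegral_mono_on hi ((hΦi.mono_set (Ioi_subset_Ioi hr.le)).div_const r)
            measurableSet_Ioi fun s hs => ?_
          exact div_le_div_of_nonneg_left (kerWeight_pos s).le hr (le_of_lt hs)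
      _ = (∫ s in Ioi r, kerWeight s) / r := MeasureTheory.integral_div _ _
      _ ≤ (∫ s in Ioi (0 : ℝ), kerWeight s) / r :=
          div_le_div_of_nonneg_right (setIntegral_mono_set hΦi
            (Eventually.of_forall fun s => (kerWeight_pos s).le)
            (Eventually.of_forall (Ioi_subset_Ioi hr.le))) hr.le
  · have h := integral_Ioi_tail_le_exp hr
    have heq : (∫ ρ in Ioi r, r ^ 2 * kerWeight ρ / ρ) = r ^ 2 * ∫ ρ in Ioi r, kerWeight ρ / ρ := by
      rw [← MeasureTheory.integral_const_mul]
      refine setIntegral_congr_fun measurableSet_Ioi fun ρ _ => ?_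
      ring
    rw [heq] at h
    exact h

/-! ### The registered tools stub -/

/-- **Registered tools stub `stub_arnoldModeOne1DToolsC`** (helpers for `stub_arnoldModeOne1D`, line
`Sketch` of crux `CoreLinearInvertibility`, stmt-NavierStokesRegularity-17973): the splitting of the
mode-one integral, the energy identity `∫(B₁f) f r = ½∫(A_f²/r³ + rB_f²)`, and the first trace
identity `∫ F/r³ = ½∫ rΦ`. [folklore] -/
theorem stub_arnoldModeOne1DToolsC :
    (∀ (f : ℝ → ℝ) (C : ℝ) (N : ℕ), Continuous f →
      (∀ r : ℝ, 0 ≤ r → |f r| ≤ C * (1 + r) ^ N * Real.exp (-(r ^ 2 / 4))) →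
      (∀ r : ℝ, 0 < r → ∫ s in Set.Ioi (0 : ℝ), min (r / s) (s / r) * f s * s =
        (∫ s in (0 : ℝ)..r, s ^ 2 * f s) / r + r * ∫ s in Set.Ioi r, f s) ∧
      ∫ r in Set.Ioi (0 : ℝ), ((1 / 2 : ℝ) * ∫ s in Set.Ioi (0 : ℝ), min (r / s) (s / r) * f s * s) * f r * r =
        (1 / 2) * ∫ r in Set.Ioi (0 : ℝ),
          ((∫ s in (0 : ℝ)..r, s ^ 2 * f s) ^ 2 / r ^ 3 + r * (∫ s in Set.Ioi r, f s) ^ 2)) ∧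
    (∫ r in Set.Ioi (0 : ℝ), (∫ s in (0 : ℝ)..r, s ^ 3 * kerWeight s) / r ^ 3 =
      (1 / 2) * ∫ r in Set.Ioi (0 : ℝ), r * kerWeight r) :=
  ⟨fun _ _ _ hf hb => ⟨fun _ hr => am1_inner_split hf hb hr, am1_energy_identity hf hb⟩,
    am1_integral_F_div_cube.2⟩

end Summit.NavierStokesRegularity.NavierStokesRegularity.Theorems
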